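import Mathlib.Analysis.InnerProductSpace.Projection.Basic
import Mathlib.Analysis.InnerProductSpace.Adjoint
import Mathlib.MeasureTheory.Function.L2Space
import Mathlib.Analysis.Fourier.LpSpace
import Mathlib.Analysis.Fourier.FourierTransform
import Mathlib.Topology.Algebra.Module.Basic
import Literature.Analysis.FluidPDE.VectorCalculus
import Literature.Analysis.FunctionSpaces.TorusSobolevSpace
import HarnessLib

-- provenance: harness21/H21/H21/Prelude/FluidKinetic/LerayProjector.lean @ f1218b6 (interim HEAD d8f2665); M5 mechanical rewrite
/-!
# The Leray (Helmholtz) projector on `L²(E; E)` and on `L²(T^d; ℝ^d)`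

Trunk: FluidKinetic (outline `H21/Outlines/FluidKinetic.md`, item F6 `LerayProjector`; notion
`leray_projector`).

Let `E` be a finite-dimensional real inner product space (physical space `ℝⁿ`). The *Leray
projector* `P` is the orthogonal projection of `L²(E; E)` onto the closed subspace `L²_σ` of
(weakly) divergence-free vector fields; its orthogonal complement is the space of `L²`
gradients (Helmholtz–Weyl decomposition), and on the Fourier side `P` is the multiplier
`P̂(ξ) = I − ξ ⊗ ξ / |ξ|²`. On the flat torus `T^d` the same projector acts on the mean-zero
energy space `H` of Constantin–Foias, with Fourier multiplier `ĉ(k) ↦ ĉ(k) − (k·ĉ(k)/|k|²) k`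
for `k ≠ 0` and `ĉ(0) ↦ 0`.

## Contents

* `Literature.Fluid.smoothSolenoidal E` — the set `𝒱` of `L²` classes of smooth compactly supported
  divergence-free vector fields; `Literature.Fluid.solenoidalL2 E = L²_σ(E)` — the `L²` closure of its
  span (an `abbrev` of a `Submodule.topologicalClosure`, so that Mathlib's instances
  `Submodule.topologicalClosure.completeSpace` and
  `Submodule.HasOrthogonalProjection.ofCompleteSpace` fire);
  `Literature.Fluid.lerayProjector E := (solenoidalL2 E).starProjection`.
* `Literature.Fluid.leraySymbol ξ = id − |ξ|⁻² ξ ⊗ ξ` (the Fourier multiplier of `P`);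
  `Literature.Fluid.gradientRange E` — the `L²` closure of `{∇q | q ∈ C_c^∞}`.
* `Literature.Analysis.FluidPDE.Torus.instCompleteSpaceEnergySpace` — the accepted `Literature.Torus.energySpace d` (a `def`,
  `Literature.Prelude.Sobolev.TorusSobolevSpace`) is complete, whence
  `Submodule.HasOrthogonalProjection (Torus.energySpace d)` by
  `Submodule.HasOrthogonalProjection.ofCompleteSpace`; `Literature.Torus.lerayProjector d :=
  (Torus.energySpace d).starProjection`; `Literature.Torus.lerayCoeff k c` — its Fourier multiplier.
* API: `lerayProjector_apply_of_mem`, `isStarProjection_lerayProjector`,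
  `lerayProjector_norm_le_one` (real proofs, from Mathlib's `starProjection` API);
  `mem_solenoidalL2_iff`, `orthogonal_solenoidalL2_eq_gradientRange` (Helmholtz),
  `fourier_lerayProjector_schwartz` (symbol), `Torus.mFourierCoeff_lerayProjector` (sorried,
  literature); `Torus.lerayProjector_eq_self_of_mem` (real).

## Mathlib search

Mathlib (this pin) has the orthogonal projection onto a complete subspace of an inner product
space as a star projection (`Submodule.starProjection`, `Submodule.HasOrthogonalProjection`,
`isStarProjection_starProjection`, `Submodule.starProjection_norm_le`,
`Submodule.starProjection_eq_self_iff`), the Hilbert space `Lp E 2 μ`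
(`MeasureTheory.L2.innerProductSpace`), the `L²` Fourier transform
`MeasureTheory.Lp.fourierTransformₗᵢ` (complex targets only) and the torus Fourier coefficients
`UnitAddTorus.mFourierCoeff`. It has no solenoidal space, no Leray/Helmholtz projector and no
Riesz transforms (grep `Leray|Helmholtz|solenoidal|divergence.free`: nothing relevant). All of
these are used, nothing is duplicated.

## Design notes

* The outline suggests carrying `[CompleteSpace E]` in the whole-space context; it turned out to
  be unnecessary: `CompleteSpace E` (needed for `Lp E 2 volume` to be a Hilbert space) is found
  by instance search from `[FiniteDimensional ℝ E]` (`FiniteDimensional.proper_real`), so the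
  context is exactly that of `Literature.Prelude.FluidKinetic.VectorCalculus`.
* `leraySymbol 0 = id` is a **junk value** (`(‖0‖ ^ 2)⁻¹ = 0` in Lean); the symbol is only
  meaningful for `ξ ≠ 0` (a null set), as documented on the declaration.
* The whole-space symbol theorem is stated componentwise and complexified: Mathlib's `L²` Fourier
  transform lives on `Lp ℂ 2`, so we transport the real field `P v` to its scalar components
  `x ↦ (⟪w, (P v) x⟫ : ℂ)` via `ContinuousLinearMap.compLp`, and use the symmetry of
  `leraySymbol ξ` to move the symbol onto the fixed vector `w`.
* On the torus, `Torus.energySpace d` is **mean-zero** (Constantin–Foias' `H`), so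
  `Torus.lerayProjector d` also removes the mean: `Torus.lerayCoeff 0 c = 0` (review finding 7a
  of the outline; statements that need the mean kept add it back explicitly).
* `Torus.instCompleteSpaceEnergySpace` is a new instance on an H21 type (outline §4.11); it
  overrides no Mathlib instance (Mathlib's `Submodule.topologicalClosure.completeSpace` does not
  fire through the irreducible `def Torus.energySpace`).

## References

* P. Constantin, C. Foias, *Navier–Stokes Equations* (Univ. Chicago Press, 1988), Ch. 4 (the
  spaces `H`, `V`, the Leray projector `P`, periodic case).
* R. Temam, *Navier–Stokes Equations. Theory and Numerical Analysis* (North-Holland, 1977),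
  Ch. I, §1.4, Thm. 1.4 and Rem. 1.6 (Helmholtz decomposition `L² = H ⊕ G`).
* P. G. Lemarié-Rieusset, *Recent Developments in the Navier–Stokes Problem* (Chapman & Hall/CRC,
  2002), Ch. 11 (the Leray projector as the Fourier multiplier `I − ξ ⊗ ξ/|ξ|²`).
-/

noncomputable section

open MeasureTheory TopologicalSpace
open scoped InnerProductSpace RealInnerProductSpace ENNReal FourierTransform

namespace Literature.Analysis.FluidPDE

section Fluid

variable {E : Type*} [NormedAddCommGroup E] [InnerProductSpace ℝ E] [FiniteDimensional ℝ E]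
  [MeasurableSpace E] [BorelSpace E]

/-! ### The solenoidal space `L²_σ(E)` and the Leray projector -/

variable (E) in
/-- The set `𝒱` of (`L²` classes of) smooth, compactly supported, divergence-free vector fields
on `E`: `v ∈ L²(E; E)` having a representative `φ ∈ C_c^∞(E; E)` (a test function in the sense
of the accepted `Literature.IsTestFunctionOn ⊤`) with `div φ = 0` (Constantin–Foias 1988, Ch. 4, the
space `𝒱`; Temam 1977, Ch. I §1.4, eq. (1.31)). [cite: ConstantinFoias1988, Ch. 4  the space  𝒱] -/
def smoothSolenoidal : Set (Lp E 2 (volume : Measure E)) :=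
  {v | ∃ φ : E → E, FunctionSpaces.IsTestFunctionOn (⊤ : Opens E) φ ∧ VectorCalculus.IsDivFree φ ∧ (v : E → E) =ᵐ[volume] φ}

variable (E) in
/-- The solenoidal space `L²_σ(E)`: the `L²` closure of the span of the smooth compactly
supported divergence-free fields `𝒱`, a closed subspace of the Hilbert space `L²(E; E)`
(Constantin–Foias 1988, Ch. 4, Def. of `H`; Temam 1977, Ch. I §1.4, Thm. 1.4). An `abbrev`, so
that `CompleteSpace (solenoidalL2 E)` and `(solenoidalL2 E).HasOrthogonalProjection` are found by
instance search. Its intrinsic description is `mem_solenoidalL2_iff`. [cite: ConstantinFoias1988, Ch. 4  Def. of  H] -/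
abbrev solenoidalL2 : Submodule ℝ (Lp E 2 (volume : Measure E)) :=
  (Submodule.span ℝ (smoothSolenoidal E)).topologicalClosure

variable (E) in
/-- The **Leray projector** `P : L²(E; E) → L²_σ(E)`, the orthogonal projection onto the
solenoidal space, as a bounded self-adjoint idempotent operator on `L²(E; E)` (Mathlib's
`Submodule.starProjection`) (Constantin–Foias 1988, Ch. 4; Temam 1977, Ch. I Thm. 1.4 and
Rem. 1.6; Lemarié-Rieusset 2002, Ch. 11). [cite: ConstantinFoias1988, Ch. 4] -/
def lerayProjector : Lp E 2 (volume : Measure E) →L[ℝ] Lp E 2 (volume : Measure E) :=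
  (solenoidalL2 E).starProjection

omit [FiniteDimensional ℝ E] [MeasurableSpace E] [BorelSpace E] in
/-- The Fourier multiplier (symbol) of the Leray projector at frequency `ξ`:
`P̂(ξ) = I − ξ ⊗ ξ / |ξ|²`, i.e. `P̂(ξ) a = a − (⟪ξ, a⟫ / |ξ|²) ξ`, the orthogonal projection of
`E` onto `ξ^⊥` (Lemarié-Rieusset 2002, Ch. 11; Constantin–Foias 1988, Ch. 4, periodic analogue).
**Junk value** at `ξ = 0`: `(‖0‖ ^ 2)⁻¹ = 0`, so `leraySymbol 0 = id`; the symbol is only used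
for `ξ ≠ 0` (a Lebesgue-null set). [cite: LemarieRieusset2002, Ch. 11] -/
def leraySymbol (ξ : E) : E →L[ℝ] E :=
  ContinuousLinearMap.id ℝ E - (‖ξ‖ ^ 2)⁻¹ • (innerSL ℝ ξ).smulRight ξ

omit [FiniteDimensional ℝ E] [MeasurableSpace E] [BorelSpace E] in
/-- Unfolding the Leray symbol: `P̂(ξ) a = a − |ξ|⁻² ⟪ξ, a⟫ ξ` (Lemarié-Rieusset 2002, Ch. 11). [cite: LemarieRieusset2002, Ch. 11] -/
theorem leraySymbol_apply (ξ a : E) :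
    leraySymbol ξ a = a - (‖ξ‖ ^ 2)⁻¹ • (⟪ξ, a⟫ • ξ) := by
  simp [leraySymbol]

variable (E) in
/-- The space `G(E)` of `L²` gradients: the `L²` closure of the span of
`{∇q | q ∈ C_c^∞(E; ℝ)}` (classes of gradients of real test functions), the orthogonal complement
of `L²_σ(E)` in the Helmholtz–Weyl decomposition `L² = L²_σ ⊕ G` (Temam 1977, Ch. I Thm. 1.4 and
Rem. 1.6; Constantin–Foias 1988, Ch. 4). See `orthogonal_solenoidalL2_eq_gradientRange`. [cite: Temam1977, Ch. I Thm. 1.4 and Rem. 1.6] -/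
def gradientRange : Submodule ℝ (Lp E 2 (volume : Measure E)) :=
  (Submodule.span ℝ
    {v : Lp E 2 (volume : Measure E) |
      ∃ q : E → ℝ, FunctionSpaces.IsTestFunctionOn (⊤ : Opens E) q ∧ (v : E → E) =ᵐ[volume] gradient q}
    ).topologicalClosure

/-! ### API -/

/-- `𝒱 ⊆ L²_σ` (Constantin–Foias 1988, Ch. 4). [cite: ConstantinFoias1988, Ch. 4] -/
theorem smoothSolenoidal_subset_solenoidalL2 :
    smoothSolenoidal E ⊆ (↑(solenoidalL2 E) : Set (Lp E 2 (volume : Measure E))) :=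
  Submodule.subset_span.trans (Submodule.le_topologicalClosure _)

/-- The Leray projector is the identity on solenoidal fields: `P v = v` for `v ∈ L²_σ`
(Constantin–Foias 1988, Ch. 4; Mathlib's `Submodule.starProjection_eq_self_iff`). [cite: ConstantinFoias1988, Ch. 4] -/
theorem lerayProjector_apply_of_mem {v : Lp E 2 (volume : Measure E)} (hv : v ∈ solenoidalL2 E) :
    lerayProjector E v = v :=
  Submodule.starProjection_eq_self_iff.mpr hv

/-- The range of the Leray projector is `L²_σ`: `P v ∈ L²_σ` (Constantin–Foias 1988, Ch. 4). [cite: ConstantinFoias1988, Ch. 4] -/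
theorem lerayProjector_apply_mem (v : Lp E 2 (volume : Measure E)) :
    lerayProjector E v ∈ solenoidalL2 E :=
  Submodule.starProjection_apply_mem _ v

/-- The Leray projector is an orthogonal projection: idempotent and self-adjoint
(`P² = P = P*`) (Constantin–Foias 1988, Ch. 4; Temam 1977, Ch. I Rem. 1.6; Mathlib's
`isStarProjection_starProjection`). [cite: ConstantinFoias1988, Ch. 4] -/
theorem isStarProjection_lerayProjector : IsStarProjection (lerayProjector E) :=
  isStarProjection_starProjection

/-- `‖P‖ ≤ 1` (Constantin–Foias 1988, Ch. 4; Mathlib's `Submodule.starProjection_norm_le`). [cite: ConstantinFoias1988, Ch. 4] -/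
theorem lerayProjector_norm_le_one : ‖lerayProjector E‖ ≤ 1 :=
  Submodule.starProjection_norm_le _

/-- Intrinsic description of `L²_σ(E)`: an `L²` vector field on the whole space lies in the
closure of the smooth compactly supported divergence-free fields iff it is weakly divergence free,
`∫ ⟪v, ∇θ⟫ = 0` for all test `θ` (Temam 1977, Ch. I Thm. 1.4 with Rem. 1.6 / Thm. 1.6 for
`Ω = ℝⁿ`: no boundary, hence no normal-trace condition; Constantin–Foias 1988, Ch. 4). [cite: Temam1977, Ch. I Thm. 1.4 with Rem. 1.6 / Thm. 1.6] -/
def mem_solenoidalL2_iff : Prop :=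
  ∀ (v : Lp E 2 (volume : Measure E)),
    v ∈ solenoidalL2 E ↔ IsWeaklyDivFree (v : E → E)

/-- **Helmholtz–Weyl decomposition** on the whole space: the orthogonal complement of `L²_σ(E)`
in `L²(E; E)` is the space of `L²` gradients, `(L²_σ)ᗮ = G` (Temam 1977, Ch. I Thm. 1.4 and
Rem. 1.6; Constantin–Foias 1988, Ch. 4). Consequently `v = P v + ∇p` with `P v ⊥ ∇p`. [cite: Temam1977, Ch. I Thm. 1.4 and Rem. 1.6] -/
def orthogonal_solenoidalL2_eq_gradientRange : Prop :=
  (solenoidalL2 E)ᗮ = gradientRange E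

/-- **The Leray projector is the Fourier multiplier `I − ξ ⊗ ξ/|ξ|²`** (Lemarié-Rieusset 2002,
Ch. 11; Constantin–Foias 1988, Ch. 4), stated componentwise on the complexified scalar components
(Mathlib's `L²` Fourier transform `MeasureTheory.Lp.fourierTransformₗᵢ` is complex-linear): for
`v ∈ L²(E; E)` with a Schwartz-class (here: test-function) representative `φ` and every fixed
direction `w : E`, the `L²` Fourier transform of the scalar field `x ↦ ⟪w, (P v)(x)⟫` is, for
a.e. `ξ`, the Fourier integral at `ξ` of `x ↦ ⟪w, P̂(ξ) φ(x)⟫`, i.e.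
`⟪w, 𝓕(P v)(ξ)⟫ = ⟪w, P̂(ξ) φ̂(ξ)⟫` (using that `P̂(ξ)` is real and symmetric). [cite: LemarieRieusset2002, Ch. 11] -/
def fourier_lerayProjector_schwartz : Prop :=
  ∀ {v : Lp E 2 (volume : Measure E)} {φ : E → E} (hφ : FunctionSpaces.IsTestFunctionOn (⊤ : Opens E) φ) (hv : (v : E → E) =ᵐ[volume] φ) (w : E),
    ((Lp.fourierTransformₗᵢ E ℂ
        ((Complex.ofRealCLM.comp (innerSL ℝ w)).compLp (lerayProjector E v)) :
          Lp ℂ 2 (volume : Measure E)) : E → ℂ) =ᵐ[volume]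
      fun ξ => 𝓕 (fun x => (⟪w, leraySymbol ξ (φ x)⟫ : ℂ)) ξ

end Fluid

/-! ### The Leray projector on the flat torus `T^d` -/

namespace Torus

open UnitAddTorus

variable {d : Type*} [Fintype d] [DecidableEq d]

/-- The energy space `H = Torus.energySpace d` (a closed subspace of `L²(T^d; ℝ^d)`, accepted in
`Literature.Prelude.Sobolev.TorusSobolevSpace` as a `def`) is complete (Constantin–Foias 1988, Ch. 4:
`H` is a Hilbert space). A new instance on an H21 type (outline §4.11): through the `def`,
Mathlib's `Submodule.topologicalClosure.completeSpace` does not fire, and this instance is what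
makes `Submodule.HasOrthogonalProjection (Torus.energySpace d)` available (via
`Submodule.HasOrthogonalProjection.ofCompleteSpace`) to this file and to `StokesTorus`,
`StatisticalSolution`. [cite: ConstantinFoias1988, Ch. 4:  H  is a Hilbert space] -/
instance instCompleteSpaceEnergySpace : CompleteSpace (FunctionSpaces.Torus.energySpace d) :=
  FunctionSpaces.Torus.isClosed_energySpace.completeSpace_coe

variable (d) in
/-- The **Leray projector on the torus** `P : L²(T^d; ℝ^d) → H`, the orthogonal projection onto
the (mean-zero, solenoidal) energy space `H = Torus.energySpace d` (Constantin–Foias 1988, Ch. 4;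
Temam 1977, Ch. I §1.4, periodic case). Since `H` is mean-zero, `P` also removes the mean
(`Torus.lerayCoeff 0 c = 0`). [cite: ConstantinFoias1988, Ch. 4] -/
def lerayProjector :
    Lp (EuclideanSpace ℝ d) 2 (volume : Measure (UnitAddTorus d)) →L[ℝ]
      Lp (EuclideanSpace ℝ d) 2 (volume : Measure (UnitAddTorus d)) :=
  (FunctionSpaces.Torus.energySpace d).starProjection

omit [DecidableEq d] in
/-- The Fourier multiplier of the torus Leray projector at the integer frequency `k : ℤ^d`,
acting on a (complex) Fourier coefficient `c = v̂(k) ∈ ℂ^d`: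
`c ↦ c − ((k · c) / |k|²) k` for `k ≠ 0` (projection onto `k^⊥`, with the bilinear pairing
`k · c = ∑ᵢ kᵢ cᵢ`, `k` being real), and `c ↦ 0` for `k = 0` — the mean is removed because
`Torus.energySpace d` is the mean-zero space `H` (Constantin–Foias 1988, Ch. 4, periodic case;
Temam 1977, Ch. I §1.4 / Rem. 1.6, `H^s_per` computations). [cite: ConstantinFoias1988, Ch. 4  periodic case] -/
def lerayCoeff (k : d → ℤ) (c : EuclideanSpace ℂ d) : EuclideanSpace ℂ d :=
  if k = 0 then 0
  else c - ((∑ i, (k i : ℂ) * c i) / (FunctionSpaces.Torus.freqNormSq k : ℂ)) • WithLp.toLp 2 fun i => (k i : ℂ)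

omit [DecidableEq d] in
/-- The zero mode is killed by the torus Leray multiplier (mean removal; Constantin–Foias 1988,
Ch. 4). [cite: ConstantinFoias1988, Ch. 4] -/
@[simp]
theorem lerayCoeff_zero (c : EuclideanSpace ℂ d) : lerayCoeff 0 c = 0 := by
  simp [lerayCoeff]

/-- The torus Leray projector is the identity on `H`: `P v = v` for `v ∈ Torus.energySpace d`
(Constantin–Foias 1988, Ch. 4; Mathlib's `Submodule.starProjection_eq_self_iff`). [cite: ConstantinFoias1988, Ch. 4] -/
theorem lerayProjector_eq_self_of_mem
    {v : Lp (EuclideanSpace ℝ d) 2 (volume : Measure (UnitAddTorus d))}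
    (hv : v ∈ FunctionSpaces.Torus.energySpace d) : lerayProjector d v = v :=
  Submodule.starProjection_eq_self_iff.mpr hv

/-- The range of the torus Leray projector is `H` (Constantin–Foias 1988, Ch. 4). [cite: ConstantinFoias1988, Ch. 4] -/
theorem lerayProjector_apply_mem
    (v : Lp (EuclideanSpace ℝ d) 2 (volume : Measure (UnitAddTorus d))) :
    lerayProjector d v ∈ FunctionSpaces.Torus.energySpace d :=
  Submodule.starProjection_apply_mem _ v

/-- The torus Leray projector is an orthogonal projection (`P² = P = P*`; Constantin–Foias 1988,
Ch. 4; Mathlib's `isStarProjection_starProjection`). [cite: ConstantinFoias1988, Ch. 4] -/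
theorem isStarProjection_lerayProjector : IsStarProjection (lerayProjector d) :=
  isStarProjection_starProjection

/-- **Fourier coefficients of the torus Leray projector**: for `v ∈ L²(T^d; ℝ^d)` and every
`k ∈ ℤ^d`, `(P v)^(k) = lerayCoeff k (v̂(k))`, i.e. `(P v)^(0) = 0` and
`(P v)^(k) = v̂(k) − ((k · v̂(k)) / |k|²) k` for `k ≠ 0`, the real fields being complexified
componentwise (`Literature.Analysis.FunctionSpaces.EuclideanSpace.complexify`) for Mathlib's `UnitAddTorus.mFourierCoeff`
(Constantin–Foias 1988, Ch. 4, periodic case; Temam 1977, Ch. I §1.4, Rem. 1.6). [cite: ConstantinFoias1988, Ch. 4  periodic case] -/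
def mFourierCoeff_lerayProjector : Prop :=
  ∀ (v : Lp (EuclideanSpace ℝ d) 2 (volume : Measure (UnitAddTorus d))) (k : d → ℤ),
    mFourierCoeff
        (FunctionSpaces.EuclideanSpace.complexify ∘
          ((lerayProjector d v : Lp (EuclideanSpace ℝ d) 2 (volume : Measure (UnitAddTorus d))) :
            UnitAddTorus d → EuclideanSpace ℝ d)) k =
      lerayCoeff k
        (mFourierCoeff (FunctionSpaces.EuclideanSpace.complexify ∘ (v : UnitAddTorus d → EuclideanSpace ℝ d))
          k)

end Torus

end Literature.Analysis.FluidPDE
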